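/- Width seat 3/3 `ym-line-cbag-p1-w3` (prover-ym-line-cbag-p1-w3-g14-0) of the cell of ideator ym-idea-2, LINE 8
(route `EguchiKawaiDirectionLadder`, crux K_A stmt-QuantumFields-27724 CLOSED): the QUANTITATIVE, every-direction form of
the route's target.  Glue on landed theorems only; YM mass gap NOT touched (barrier-ledger line). -/
import Summits.QuantumFields.YangMills.Theorems.EguchiKawaiDirectionLadderSymFibreBound
import Summits.QuantumFields.YangMills.Theorems.EguchiKawaiDirectionLadderSymFibreDoor
import Summits.QuantumFields.YangMills.Theorems.EguchiKawaiDirectionLadderBreakdownOfTripleMargin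
import HarnessLib

/-!
# Route `EguchiKawaiDirectionLadder`: the Eguchi–Kawai order parameter has an explicit FLOOR in every direction

The barrier-ledger fact `Literature.Barriers.QuantumFields.EguchiKawaiBreakdown` (proved by this cell: K_A
`tripleSmallBallMargin_proof`, K_B `directionIncrement_unconditional`, Assembly) only says that for `d ≥ 3` and all weak
't Hooft couplings `b > b₀` the open-line order parameter `⟨|(1/N) tr U_μ|²⟩_EK` fails to tend to `0` in SOME direction;
its docstring records (scope caveat (b)) that neither uniformity in the direction `μ` nor a floor is asserted.  Both are
cheap consequences of what the cell landed, and this file proves them with explicit constants: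

* `ekSymSmallBallBound_three_explicit` — the `d = 3` centre-symmetric small-ball bound with the cell's constants BY VALUE:
  width `δ = 1/10`, exponent `e = 4/5` (`symFibre_bound` through the Weyl/first-link door);
* `ekSymSmallBallBound_explicit` — for every `d ≥ 3`: width `1/(20d)`, exponent `d/4 + (d+3)/(40d) > d/4`
  (shrink the width, then iterate the landed one-direction increment `(1 − 2δ)/4` from `d = 3`);
* `ekSymRegionProb_le_exp_neg_sq` — SUPPRESSION WITH A RATE: for every `d ≥ 3` there is `b₀` such that for `b > b₀` the Gibbs
  probability of the centre-symmetric region `Sym_{1/(20d)} = {∀ μ, |(1/N) tr U_μ|² ≤ 1/(20d)}` is `≤ e^{−N²}` for all large `N`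
  (free-energy comparison: collapsed-vacuum lower bound `ekPartitionLowerBound_holds`, exponent `d/4`, against the
  layer-cake upper bound `ekSymRegionUpperBound_of_smallBall`, exponent `> d/4`);
* `ekOrderParameter_floor` — THE FLOOR: for every `d ≥ 3` there is `b₀ ≥ 0` such that for every `b > b₀`, EVERY direction
  `μ` and all large `N`, `⟨|(1/N) tr U_μ|²⟩_EK ≥ 1/(40 d²)` (order-parameter inequality
  `mul_one_sub_prob_le_sum_ekOrderParameter` + direction symmetry `ekOrderParameter_eq`);
* `eguchiKawaiBreakdown_quantitative` — packaged with `∀ᶠ N`, and `eguchiKawaiBreakdown_allDirections` — the named fact's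
  shape with `∀ μ` in place of `∃ μ`.

HONEST FRAMING.  This is the Eguchi–Kawai BREAKDOWN direction (negative knowledge about the naive, untwisted single-site
reduction at weak coupling); no summit statement, no mass gap, no continuum limit and no large-`N` reduction is proved or
advanced here.  The floor `1/(40d²)` is what the cell's constants give, not a claim about the true `N = ∞` value.
-/

set_option autoImplicit false

noncomputable section

open MeasureTheory Filter Topology
open Literature.Barriers.QuantumFields

namespace Summit.QuantumFields.YangMills.Theorems.EguchiKawaiDirectionLadder

/-! ## The small-ball bounds with explicit width and exponent -/

/-- **`d = 3` with the cell's constants by value**: `EKSymSmallBallBound 3 (1/10) (4/5) C` for some `C`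
(`symFibre_bound` through `ekSymSmallBallBound_three_of_symFibreBound_trace`). -/
theorem ekSymSmallBallBound_three_explicit : ∃ C : ℝ, EKSymSmallBallBound 3 (1 / 10) (4 / 5) C := by
  obtain ⟨C, t₀, ht₀, N₀, h⟩ := symFibre_bound
  exact ⟨_, ekSymSmallBallBound_three_of_symFibreBound_trace (N₀ := N₀) (by norm_num) ht₀ h⟩

/-- **Every `d ≥ 3`, explicit width and exponent**: `EKSymSmallBallBound d (1/(20d)) (d/4 + (d+3)/(40d)) C` for some `C`.
Shrink the width from `1/10` to `1/(20d)` (`ekSymSmallBallBound_mono_delta`), then climb from `d = 3` by the landed increment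
`DirectionIncrement` (each new direction adds `(1 − 2δ)/4 = 1/4 − 1/(40d)` to the exponent):
`4/5 + (d − 3)(1/4 − 1/(40d)) = d/4 + (d + 3)/(40d)`. -/
theorem ekSymSmallBallBound_explicit (d : ℕ) (hd : 3 ≤ d) :
    ∃ C : ℝ, EKSymSmallBallBound d (1 / (20 * d)) ((d : ℝ) / 4 + ((d : ℝ) + 3) / (40 * d)) C := by
  obtain ⟨C₃, h3⟩ := ekSymSmallBallBound_three_explicit
  have hd0 : (0 : ℝ) < d := by exact_mod_cast (show 0 < d by omega)
  have hd3 : (3 : ℝ) ≤ d := by exact_mod_cast hd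
  have hδpos : (0 : ℝ) < 1 / (20 * d) := by positivity
  have hδle : (1 : ℝ) / (20 * d) ≤ 1 / 10 :=
    one_div_le_one_div_of_le (by norm_num) (by nlinarith)
  have hδhalf : (1 : ℝ) / (20 * d) < 1 / 2 :=
    one_div_lt_one_div_of_lt (by norm_num) (by nlinarith)
  have h3' : EKSymSmallBallBound 3 (1 / (20 * d)) (4 / 5) C₃ := ekSymSmallBallBound_mono_delta hδle h3
  obtain ⟨C, hC⟩ := ekSymSmallBallBound_iterate directionIncrement_unconditional hδpos hδhalf h3' (d - 3)
  have hdd : 3 + (d - 3) = d := by omega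
  rw [hdd] at hC
  refine ⟨C, ?_⟩
  have hcast : ((d - 3 : ℕ) : ℝ) = (d : ℝ) - 3 := by
    rw [Nat.cast_sub hd]; norm_num
  have he : (4 : ℝ) / 5 + ((d - 3 : ℕ) : ℝ) * ((1 - 2 * (1 / (20 * (d : ℝ)))) / 4) =
      (d : ℝ) / 4 + ((d : ℝ) + 3) / (40 * d) := by
    rw [hcast]
    field_simp
    ring
  rw [he] at hC
  exact hC

/-! ## Suppression of the centre-symmetric region with the rate `e^{−N²}` -/

/-- **Free-energy comparison with a rate.** From a collapsed-vacuum lower bound `Z_N(b) ≥ exp(−N²((d/4) log b + C₁))`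
and a centre-symmetric upper bound `∫_{Sym_δ} ≤ exp(−N²(e log b − C₂))` with `e > d/4`: for every
`b > b₀ := max 1 (exp((C₁ + C₂ + 1)/(e − d/4)))` and all `N ≥ max N₁ N₂`, `P_{N,b}(Sym_δ) ≤ e^{−N²}`.
(The estimate inside the tree's `suppressed_of_bounds`, exported with its threshold.) -/
theorem ekSymRegionProb_le_exp_neg_sq_of_bounds {d : ℕ} {δ e C₁ C₂ : ℝ} (hLB : EKPartitionLowerBound d C₁)
    (hUB : EKSymRegionUpperBound d δ e C₂) (he : (d : ℝ) / 4 < e) :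
    ∃ b₀ : ℝ, 0 ≤ b₀ ∧ ∀ b : ℝ, b₀ < b → ∃ N₀ : ℕ, ∀ N : ℕ, N₀ ≤ N →
      ekSymRegionProb d N b δ ≤ Real.exp (-((N : ℝ) ^ 2)) := by
  obtain ⟨N₁, h₁⟩ := hLB
  obtain ⟨N₂, h₂⟩ := hUB
  set gap : ℝ := e - (d : ℝ) / 4 with hgap
  have hgap_pos : 0 < gap := by rw [hgap]; linarith
  refine ⟨max 1 (Real.exp ((C₁ + C₂ + 1) / gap)), le_max_of_le_left zero_le_one, fun b hb => ?_⟩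
  have hb1 : 1 < b := lt_of_le_of_lt (le_max_left _ _) hb
  have hbexp : Real.exp ((C₁ + C₂ + 1) / gap) < b := lt_of_le_of_lt (le_max_right _ _) hb
  have hbpos : 0 < b := lt_trans zero_lt_one hb1
  have hlog : (C₁ + C₂ + 1) / gap < Real.log b := by
    rw [Real.lt_log_iff_exp_lt hbpos]; exact hbexp
  have hkey : C₁ + C₂ + 1 < gap * Real.log b := by
    rwa [div_lt_iff₀ hgap_pos, mul_comm] at hlog
  refine ⟨max N₁ N₂, fun N hN => ?_⟩
  have hN₁ : N₁ ≤ N := le_trans (le_max_left _ _) hN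
  have hN₂ : N₂ ≤ N := le_trans (le_max_right _ _) hN
  have hZ := h₁ N hN₁ b hb1.le
  have hS := h₂ N hN₂ b hb1.le
  have hZpos : 0 < ∫ U, ekWeight N b U ∂ekHaar d N := ekPartition_pos d N b
  rw [ekSymRegionProb_eq, div_le_iff₀ hZpos]
  refine hS.trans ?_
  refine le_trans ?_ (mul_le_mul_of_nonneg_left hZ (Real.exp_pos _).le)
  rw [← Real.exp_add, Real.exp_le_exp]
  have hN2 : (0 : ℝ) ≤ (N : ℝ) ^ 2 := by positivity
  have hmul : (N : ℝ) ^ 2 * (C₁ + C₂ + 1) ≤ (N : ℝ) ^ 2 * (gap * Real.log b) :=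
    mul_le_mul_of_nonneg_left hkey.le hN2
  rw [hgap] at hmul
  nlinarith

/-- **Suppression of `Sym_{1/(20d)}` with the rate `e^{−N²}` at weak coupling**, for every `d ≥ 3`: there is `b₀ ≥ 0` such
that for every `b > b₀` and all large `N`, `P_{N,b}(∀ μ, |(1/N) tr U_μ|² ≤ 1/(20d)) ≤ e^{−N²}` — the measure-theoretic form
of "for `d ≥ 3` the eigenvalues collapse", now with a rate. -/
theorem ekSymRegionProb_le_exp_neg_sq (d : ℕ) (hd : 3 ≤ d) :
    ∃ b₀ : ℝ, 0 ≤ b₀ ∧ ∀ b : ℝ, b₀ < b → ∃ N₀ : ℕ, ∀ N : ℕ, N₀ ≤ N →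
      ekSymRegionProb d N b (1 / (20 * d)) ≤ Real.exp (-((N : ℝ) ^ 2)) := by
  obtain ⟨C, hC⟩ := ekSymSmallBallBound_explicit d hd
  have hd0 : (0 : ℝ) < d := by exact_mod_cast (show 0 < d by omega)
  have he : (d : ℝ) / 4 < (d : ℝ) / 4 + ((d : ℝ) + 3) / (40 * d) := by
    have : (0 : ℝ) < ((d : ℝ) + 3) / (40 * d) := by positivity
    linarith
  have he0 : (0 : ℝ) < (d : ℝ) / 4 + ((d : ℝ) + 3) / (40 * d) := lt_trans (by positivity) he
  exact ekSymRegionProb_le_exp_neg_sq_of_bounds (ekPartitionLowerBound_holds d)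
    (ekSymRegionUpperBound_of_smallBall he0 hC) he

/-! ## The floor -/

/-- **The Eguchi–Kawai order parameter has the floor `1/(40d²)` in EVERY direction at weak coupling.** For every `d ≥ 3`
there is `b₀ ≥ 0` such that for every inverse 't Hooft coupling `b > b₀`, every direction `μ` and all large `N`,
`1/(40 d²) ≤ ⟨|(1/N) tr U_μ|²⟩_EK`.  Proof: `δ(1 − P_{N,b}(Sym_δ)) ≤ Σ_ν ⟨|(1/N) tr U_ν|²⟩ = d·⟨|(1/N) tr U_μ|²⟩`
(direction symmetry) with `δ = 1/(20d)` and `P ≤ e^{−N²} ≤ 1/2`. -/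
theorem ekOrderParameter_floor (d : ℕ) (hd : 3 ≤ d) :
    ∃ b₀ : ℝ, 0 ≤ b₀ ∧ ∀ b : ℝ, b₀ < b → ∀ μ : Fin d, ∃ N₀ : ℕ, ∀ N : ℕ, N₀ ≤ N →
      1 / (40 * (d : ℝ) ^ 2) ≤ ekOrderParameter d N b μ := by
  obtain ⟨b₀, hb₀, hb⟩ := ekSymRegionProb_le_exp_neg_sq d hd
  have hd0 : (0 : ℝ) < d := by exact_mod_cast (show 0 < d by omega)
  refine ⟨b₀, hb₀, fun b hbb μ => ?_⟩
  obtain ⟨N₀, hN⟩ := hb b hbb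
  refine ⟨max N₀ 1, fun N hNN => ?_⟩
  have hN₀ : N₀ ≤ N := le_trans (le_max_left _ _) hNN
  have hN1 : (1 : ℝ) ≤ N := by exact_mod_cast le_trans (le_max_right _ _) hNN
  -- `P ≤ e^{−N²} ≤ e^{−1} ≤ 1/2`
  have hP : ekSymRegionProb d N b (1 / (20 * d)) ≤ 1 / 2 := by
    refine (hN N hN₀).trans ?_
    have h1 : Real.exp (-((N : ℝ) ^ 2)) ≤ Real.exp (-1) := by
      rw [Real.exp_le_exp]
      nlinarith
    refine h1.trans ?_
    have h2 : Real.exp (-1) < 1 / 2 := by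
      have := Real.exp_one_gt_d9
      rw [Real.exp_neg, inv_lt_comm₀ (Real.exp_pos 1) (by norm_num)]
      linarith
    exact h2.le
  -- the order-parameter inequality and direction symmetry
  have hkey := mul_one_sub_prob_le_sum_ekOrderParameter d N b (1 / (20 * d))
  have hsum : ∑ ν : Fin d, ekOrderParameter d N b ν = d * ekOrderParameter d N b μ := by
    rw [Finset.sum_congr rfl fun ν _ => ekOrderParameter_eq d N b ν μ]
    simp
  rw [hsum] at hkey
  have hhalf : (1 : ℝ) / (20 * d) * (1 / 2) ≤ 1 / (20 * d) * (1 - ekSymRegionProb d N b (1 / (20 * d))) :=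
    mul_le_mul_of_nonneg_left (by linarith) (by positivity)
  have h := hhalf.trans hkey
  rw [div_le_iff₀ (by positivity)]
  have h' : (1 : ℝ) / (20 * d) * (1 / 2) * (40 * (d : ℝ) ^ 2) = d := by
    field_simp
    ring
  calc (1 : ℝ) = 1 / (20 * d) * (1 / 2) * (40 * (d : ℝ) ^ 2) / d := by
        rw [h']; field_simp
    _ ≤ d * ekOrderParameter d N b μ * (40 * (d : ℝ) ^ 2) / d := by
        gcongr
    _ = ekOrderParameter d N b μ * (40 * (d : ℝ) ^ 2) := by
        field_simp

/-- **Quantitative Eguchi–Kawai breakdown (packaged).** For every `d ≥ 3` there are `c > 0` (namely `1/(40d²)`) and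
`b₀ ≥ 0` such that for every `b > b₀` and EVERY direction `μ`, eventually in `N`, `c ≤ ⟨|(1/N) tr U_μ|²⟩_EK`. -/
theorem eguchiKawaiBreakdown_quantitative (d : ℕ) (hd : 3 ≤ d) :
    ∃ c : ℝ, 0 < c ∧ ∃ b₀ : ℝ, 0 ≤ b₀ ∧ ∀ b : ℝ, b₀ < b → ∀ μ : Fin d,
      ∀ᶠ N : ℕ in atTop, c ≤ ekOrderParameter d N b μ := by
  obtain ⟨b₀, hb₀, hb⟩ := ekOrderParameter_floor d hd
  have hd0 : (0 : ℝ) < d := by exact_mod_cast (show 0 < d by omega)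
  refine ⟨1 / (40 * (d : ℝ) ^ 2), by positivity, b₀, hb₀, fun b hbb μ => ?_⟩
  obtain ⟨N₀, hN⟩ := hb b hbb μ
  filter_upwards [eventually_ge_atTop N₀] with N hNN using hN N hNN

/-- **The named fact with `∀ μ` in place of `∃ μ`** (uniformity in the direction, scope caveat (b) of the barrier entry):
for every `d ≥ 3` there is `b₀ ≥ 0` such that for all `b > b₀` and EVERY direction `μ` the order parameter
`⟨|(1/N) tr U_μ|²⟩_EK` does not tend to `0`. -/
theorem eguchiKawaiBreakdown_allDirections (d : ℕ) (hd : 3 ≤ d) :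
    ∃ b₀ : ℝ, 0 ≤ b₀ ∧ ∀ b : ℝ, b₀ < b → ∀ μ : Fin d,
      ¬ Tendsto (fun N : ℕ => ekOrderParameter d N b μ) atTop (𝓝 0) := by
  obtain ⟨c, hc, b₀, hb₀, hb⟩ := eguchiKawaiBreakdown_quantitative d hd
  refine ⟨b₀, hb₀, fun b hbb μ hlim => ?_⟩
  have hev := hb b hbb μ
  have hle : c ≤ 0 := ge_of_tendsto hlim hev
  linarith

end Summit.QuantumFields.YangMills.Theorems.EguchiKawaiDirectionLadder

end
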